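import Literature.MathematicalPhysics.QuantumFieldTheory.Balaban1983to89.B15Prop1CriticalAtBoxG0

/-!
# `Balaban1983to89.B15Prop1ChartRecentering` — [Balaban1989LargeFieldII] p. 359 *«we consider the variational problem for the function
# V′↾_Λ → A(U_{k,Z}(V′V_k)) … we can write V′ = exp iB′. We expand the function with respect to B′»*: RE-CENTERING THE EXPONENTIAL CHART —
# differentiability of print's function of `B′` AT a chart point gives differentiability of the LEFT-MULTIPLICATIVE chart AROUND that point,
# so the g4 letter `hF` of the N12∕s1 endpoint is DERIVED from a letter about print's own function `B′ ↦ A(U_{k,Z}(exp(iB′)·Ṽ_k))`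

statement-level skeleton of published theorems with citation tags; proofs where landed; nothing here is a claim about
the Yang–Mills mass gap

Cell pub-ymgap, HUMAN RULING D-0062 (Track A full width), seat `pub-ymgap-dag-n12-c` (R134 acceleration seat (a), strategy s1 of DAG node
N12 = [B15]; generation g4, fourth product).  PDF held: `paper:balaban1989-cmp122-large-field-ii` (journal page = PDF page + 354; p. 359 = PDF 5).

THE PRINT AND THE LETTER.  p. 359 works throughout with ONE function of the chart coordinate `B′` around the fixed extension `Ṽ_k`:
`B′ ↦ A(U_{k,Z}(exp(iB′)·Ṽ_k))`, which it *«expand[s] … with respect to B′»*.  The g4 endpoint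
`B15Prop1CriticalAtBoxG0.exists_domain_prop1Printed_lfVarOn_std_su2_box_of_fderiv` displays, besides the first-variation letter (m5) `hA`
about this function, a differentiability letter `hF` about the RE-CENTRED charts `A ↦ A(U_{k,Z}((exp iA)·V))` at the chart points
`V = exp(i·ιA B)·Ṽ_k`.  THIS FILE derives `hF` from differentiability of print's function itself at the points `B′ = ιA B`: the two charts
differ by the bondwise map `A ↦ (1/i) log(exp(iA)·exp(iX))` (`recenter X`), which satisfies `exp(i·recenter X A)·U = exp(iA)·(exp(iX)·U)`
EXACTLY (the chart logarithm is a global right inverse) and is differentiable at `A = 0` when `|X| < π` (the logarithm is differentiable off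
the poles `±1`; at `X(b) = 0` through the arcsine lift of `B15Prop1ChartCalculusSU2`).

WHAT THIS FILE PROVES (Mathlib + the import; no `sorry`, no `… : Prop` fact, no `instance`, no `notation`; `reL`, `recenter` are explicit
objects with bodies; axioms standard).
§1 ONE BOND: `reL : ℍ →L[ℝ] ℝ`; `imVec_coe`, `imVec_exp_imQuat` (`imVec exp(ιx) = sinc‖x‖·x`); ★ `differentiableAt_logVec` (pv26's `logVec` is
   differentiable at every quaternion with `im ≠ 0`, `re ≠ ±1`); `ilog_iexp_of_norm_lt` (`(1/i) log (exp ix) = x` for `‖x‖ < π`);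
   ★ `differentiableAt_log_exp_mul` (`a ↦ logVec(exp(ιa)·exp(ιx))` differentiable at `0` for `‖x‖ < π`).
§2 LATTICE: `recenter X A (b) = (1/i) log(exp(iA(b))·exp(iX(b)))`, `expMul_recenter`, `recenter_zero`, `differentiableAt_recenter`;
   ★★ `exists_hasFDerivAt_of_differentiableAt`: differentiability of `B′ ↦ f(exp(iB′)·U)` at `X` (`|X(b)| < π`) ⇒ `A ↦ f(exp(iA)·exp(iX)·U)`
   has a Fréchet derivative at `0`.
§3 ★★ `exists_domain_prop1Printed_lfVarOn_std_su2_box_of_differentiableAt` — the g4 endpoint with `hF` REPLACED by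
   `hG : DifferentiableAt ℝ (B′ ↦ A(U_{k,Z}(exp(iB′)·Ṽ_k))) (ιA B)` for `‖B‖ ≤ r` — a letter about print's own function, in print's coordinates.

HONEST SCOPE.  (i) `hG`, like `hA`, is a regularity property of [15]'s minimiser composed with the Wilson action — a NODE 00 piece of record; this
file does not prove it, it only aligns the two differentiability letters on ONE function.  (ii) `SU(2)`; `‖B‖ ≤ r ≤ 1/2` as in the endpoint.
Count-neutral; NOT a discharge of N12; NOT summit progress; nothing continuum ∕ OS ∕ mass-gap ∕ Clay.
-/

noncomputable section

open Set Finset NormedSpace Filter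
open scoped BigOperators Matrix RealInnerProductSpace Real Quaternion Topology
open Classical

namespace Literature.MathematicalPhysics.QuantumFieldTheory.Balaban1983to89.B15Prop1ChartRecentering

open Literature.MathematicalPhysics.QuantumLattice (su2Quat quatToSU2 norm_su2Quat quatToSU2_su2Quat su2Quat_ne_zero)
open B15DeterminingSets GaugeField B16Sect1Backgrounds B15Prop1Carrier B8Eq17ClassAkV1
open B15Prop1CarrierOnSU2Box B15Prop1SliceIneq18 B15Prop1CarrierOnSU2BoxIneq19 B15Prop1CarrierOnSU2BoxExt193 B15Prop1SliceIneq167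
open B15Prop1StdInstanceSU2Box B15Prop1LipschitzFromProp4 B15Prop1AdjointOfRecord B15Prop1CriticalViaSlice B15Prop1ChartCalculusSU2
open B15Prop1CriticalAtBoxG0
open T4CubeChartGnomonic (SU2)
open B15Prop1ChartSU2 (su2Chart su2Chart_iexp su2Chart_ilog)
open B15Prop1SliceCoordinates (GaugeSlice ιA freeBonds norm_ιA_apply_le)
open T4AxialGaugeSmallField (castSite boxPlaqs)
open T4HaarSU2ExpChart (imQuat imQuat_apply imQuat_re norm_imQuat norm_exp_imQuat expPoint expPoint_zero su2Quat_expPoint injOn_expPoint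
  exp_imQuat exp_imQuat_re)
open T4ExpWindowSmallField (imVec logVec norm_logVec expPoint_logVec)
open T4HaarSU2Translate (su2Quat_mul)
open B6BondElimination (unitVec)
open B16Eq18Proof (box)
open B15Extension193 (extend)
open B15ShellGauge193 (shellGauge)
open B5Bounds167Lattice (formDk ofRealCfg)
open B14.Eq213DetSet B14.Eq216Concrete B14.Eq12InteriorLocality B15Sect1Instances B15Eq177GaugeInvariance
open Literature.MathematicalPhysics.QuantumFieldTheory.BalabanImbrieJaffe1984to88.BIJ85Eq453GaugeField
open B11Prop6Scheme (Prop4Hyp)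

variable {P : Params}

/-! ## §1 One bond: the chart logarithm off the poles; the re-centering map at `0` -/

/-- The real part as a continuous linear map `ℍ →L[ℝ] ℝ`. [folklore] -/
def reL : ℍ →L[ℝ] ℝ :=
  LinearMap.toContinuousLinearMap { toFun := fun q : ℍ => q.re, map_add' := fun p q => by simp, map_smul' := fun c q => by simp }

/-- `reL q = re q`. [folklore] -/
@[simp] private theorem reL_apply (q : ℍ) : reL q = q.re := rfl

/-- A real quaternion has no imaginary vector. [folklore] -/
private theorem imVec_coe (r : ℝ) : imVec (r : ℍ) = 0 := by
  ext i
  fin_cases i <;> simp [imVec]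

/-- `imVec (c • p) = c • imVec p`. [folklore] -/
private theorem imVec_smul' (c : ℝ) (p : ℍ) : imVec (c • p) = c • imVec p := by
  ext i
  fin_cases i <;> simp [imVec]

/-- `imVec (p + q) = imVec p + imVec q`. [folklore] -/
private theorem imVec_add' (p q : ℍ) : imVec (p + q) = imVec p + imVec q := by
  ext i
  fin_cases i <;> simp [imVec]

/-- **`imVec exp(ιx) = sinc‖x‖ · x`** (pv26's closed form `exp(ιx) = cos‖x‖ + sinc‖x‖·ιx`). [cite: Balaban1989LargeFieldII, (1.19) p.360] -/
theorem imVec_exp_imQuat (x : E3) : imVec (exp (imQuat x)) = Real.sinc ‖x‖ • x := by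
  rw [exp_imQuat, imVec_add', imVec_coe, imVec_smul', imVec_imQuat, zero_add]

/-- **THE CHART LOGARITHM IS DIFFERENTIABLE OFF THE POLES**: pv26's `logVec` is (Fréchet) differentiable at every quaternion `q₀` with
`im q₀ ≠ 0` and `re q₀ ≠ ±1` (near `q₀` it is `(arccos re q ∕ ‖im q‖)·im q`). [cite: Balaban1989LargeFieldII, (1.16) p.360] -/
theorem differentiableAt_logVec {q₀ : ℍ} (him : imVec q₀ ≠ 0) (hre1 : q₀.re ≠ -1) (hre2 : q₀.re ≠ 1) :
    DifferentiableAt ℝ logVec q₀ := by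
  have hopen : ∀ᶠ q in 𝓝 q₀, imVec q ≠ 0 := by
    have h : ContinuousAt (fun q : ℍ => imVecL q) q₀ := imVecL.continuous.continuousAt
    exact h.eventually_ne (by simpa using him)
  have heq : logVec =ᶠ[𝓝 q₀] fun q : ℍ => (Real.arccos q.re * ‖imVec q‖⁻¹) • imVec q :=
    hopen.mono fun q hq => by unfold logVec; rw [if_neg hq, div_eq_mul_inv]
  have h0 : DifferentiableAt ℝ (fun q : ℍ => q.re) q₀ := reL.differentiableAt
  have h1 : DifferentiableAt ℝ (fun q : ℍ => Real.arccos q.re) q₀ := (Real.differentiableAt_arccos.2 ⟨hre1, hre2⟩).comp q₀ h0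
  have h3 : DifferentiableAt ℝ (fun q : ℍ => imVec q) q₀ := imVecL.differentiableAt
  have h2 : DifferentiableAt ℝ (fun q : ℍ => ‖imVec q‖) q₀ := h3.norm ℝ him
  have h4 : DifferentiableAt ℝ (fun q : ℍ => ‖imVec q‖⁻¹) q₀ := h2.inv (norm_ne_zero_iff.2 him)
  exact ((h1.mul h4).smul h3).congr_of_eventuallyEq heq

/-- **`(1/i) log (exp ix) = x` for `‖x‖ < π`** (the chart is injective on the ball, `injOn_expPoint`, and `‖(1/i) log (exp ix)‖ = arccos cos ‖x‖ =
‖x‖`). [cite: Balaban1989LargeFieldII, (1.16) p.360] -/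
theorem ilog_iexp_of_norm_lt {x : E3} (hx : ‖x‖ < π) : su2Chart.ilog (su2Chart.iexp x) = x := by
  have h1 : expPoint (su2Chart.ilog (su2Chart.iexp x)) = expPoint x := by
    rw [su2Chart_iexp, su2Chart_ilog]; exact expPoint_logVec _
  have h2 : ‖su2Chart.ilog (su2Chart.iexp x)‖ < π := by
    rw [su2Chart_iexp, su2Chart_ilog, norm_logVec, su2Quat_expPoint, exp_imQuat_re, Real.arccos_cos (norm_nonneg _) hx.le]
    exact hx
  exact injOn_expPoint (mem_ball_zero_iff.2 h2) (mem_ball_zero_iff.2 hx) h1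

/-- **THE ONE-BOND RE-CENTERING MAP IS DIFFERENTIABLE AT `0`**: `a ↦ logVec(exp(ιa)·exp(ιx))` is differentiable at `a = 0` for `‖x‖ < π` —
at `x = 0` through the arcsine lift (`B15Prop1ChartCalculusSU2.hasFDerivAt_asinLift_zero`, `logVec_eq_asinLift`), at `x ≠ 0` because `logVec` is
differentiable at `exp(ιx)` (`re = cos‖x‖ ∈ (−1, 1)`, `im = sinc‖x‖·x ≠ 0`). [cite: Balaban1989LargeFieldII, p.359 («we can write V′ = exp iB′»)] -/
theorem differentiableAt_log_exp_mul {x : E3} (hx : ‖x‖ < π) :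
    DifferentiableAt ℝ (fun a : E3 => logVec (exp (imQuat a) * exp (imQuat x))) 0 := by
  by_cases hx0 : x = 0
  · subst hx0
    have hs : (fun a : E3 => logVec (exp (imQuat a) * exp (imQuat (0 : E3)))) = fun a => logVec (exp (imQuat a)) := by
      funext a; rw [map_zero, NormedSpace.exp_zero, mul_one]
    rw [hs]
    have hcont : ContinuousAt (fun a : E3 => (exp (imQuat a)).re) 0 :=
      Quaternion.continuous_re.continuousAt.comp (hasFDerivAt_exp_imQuat 0).continuousAt
    have hpos : (0 : ℝ) < (exp (imQuat (0 : E3))).re := by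
      rw [map_zero, NormedSpace.exp_zero]; simp
    have hre : ∀ᶠ a in 𝓝 (0 : E3), 0 ≤ (exp (imQuat a)).re :=
      (hcont.eventually (lt_mem_nhds hpos)).mono fun a ha => le_of_lt ha
    have heq : (fun a : E3 => logVec (exp (imQuat a))) =ᶠ[𝓝 0] (asinLift ∘ fun a : E3 => imVecL (exp (imQuat a))) :=
      hre.mono fun a ha => by
        show logVec (exp (imQuat a)) = asinLift (imVec (exp (imQuat a)))
        exact logVec_eq_asinLift (norm_exp_imQuat a) ha
    have h1 : DifferentiableAt ℝ (fun a : E3 => imVecL (exp (imQuat a))) 0 :=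
      imVecL.differentiableAt.comp 0 (hasFDerivAt_exp_imQuat 0).differentiableAt
    have h0 : imVecL (exp (imQuat (0 : E3))) = 0 := by
      rw [map_zero, NormedSpace.exp_zero, imVecL_apply]; exact imVec_coe 1
    have hΦ : DifferentiableAt ℝ asinLift ((fun a : E3 => imVecL (exp (imQuat a))) 0) := by
      show DifferentiableAt ℝ asinLift (imVecL (exp (imQuat (0 : E3))))
      rw [h0]; exact hasFDerivAt_asinLift_zero.differentiableAt
    exact (hΦ.comp (0 : E3) h1).congr_of_eventuallyEq heq
  · have hn : 0 < ‖x‖ := norm_pos_iff.2 hx0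
    have hre : (exp (imQuat x)).re = Real.cos ‖x‖ := exp_imQuat_re x
    have hcos1 : Real.cos ‖x‖ < 1 := by
      have := Real.cos_lt_cos_of_nonneg_of_le_pi le_rfl hx.le hn
      rwa [Real.cos_zero] at this
    have hcos2 : -1 < Real.cos ‖x‖ := by
      have := Real.cos_lt_cos_of_nonneg_of_le_pi hn.le le_rfl hx
      rwa [Real.cos_pi] at this
    have hsinc : 0 < Real.sinc ‖x‖ := by
      rw [Real.sinc_of_ne_zero hn.ne']
      exact div_pos (Real.sin_pos_of_pos_of_lt_pi hn hx) hn
    have him : imVec (exp (imQuat x)) ≠ 0 := by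
      rw [imVec_exp_imQuat]; exact smul_ne_zero hsinc.ne' hx0
    have hlog : DifferentiableAt ℝ logVec (exp (imQuat (0 : E3)) * exp (imQuat x)) := by
      rw [map_zero, NormedSpace.exp_zero, one_mul]
      exact differentiableAt_logVec him (by rw [hre]; exact ne_of_gt hcos2) (by rw [hre]; exact ne_of_lt hcos1)
    have hg : DifferentiableAt ℝ (fun a : E3 => exp (imQuat a) * exp (imQuat x)) 0 :=
      (hasFDerivAt_exp_imQuat 0).differentiableAt.mul_const _
    exact hlog.comp 0 hg

/-! ## §2 The lattice: re-centering the chart at a chart point -/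

section Lattice

variable {k : ℕ}

/-- **THE RE-CENTERING MAP** `recenter X A (b) = (1/i) log(exp(iA(b))·exp(iX(b)))`: the chart coordinate, relative to `U`, of the
configuration `exp(iA)·(exp(iX)·U)`. [cite: Balaban1989LargeFieldII, p.359 («we can write V′ = exp iB′»)] -/
def recenter (X A : VecField P k E3) : VecField P k E3 := fun b => su2Chart.ilog (su2Chart.iexp (A b) * su2Chart.iexp (X b))

/-- **`exp(i·recenter X A)·U = exp(iA)·(exp(iX)·U)`** for ALL `A`, `X` (global right inverse). [cite: Balaban1989LargeFieldII, p.359] -/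
theorem expMul_recenter (X A : VecField P k E3) (U : GaugeField P k SU2) :
    expMul su2Chart (recenter X A) U = expMul su2Chart A (expMul su2Chart X U) := by
  funext b
  simp only [expMul, recenter]
  rw [B15Prop1ChartSU2.iexp_ilog, mul_assoc]

/-- `recenter X 0 = X` when `|X(b)| < π` for every bond. [cite: Balaban1989LargeFieldII, p.359] -/
theorem recenter_zero {X : VecField P k E3} (hX : ∀ b, ‖X b‖ < π) : recenter X 0 = X := by
  funext b
  simp only [recenter, Pi.zero_apply]
  rw [su2Chart.iexp_zero, one_mul, ilog_iexp_of_norm_lt (hX b)]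

/-- The re-centering map is differentiable at `A = 0` (bondwise `differentiableAt_log_exp_mul`). [cite: Balaban1989LargeFieldII, p.359] -/
theorem differentiableAt_recenter {X : VecField P k E3} (hX : ∀ b, ‖X b‖ < π) : DifferentiableAt ℝ (recenter X) 0 := by
  refine differentiableAt_pi.2 fun b => ?_
  have heq : (fun A : VecField P k E3 => recenter X A b) =
      (fun a : E3 => logVec (exp (imQuat a) * exp (imQuat (X b)))) ∘ fun A : VecField P k E3 => A b := by
    funext A
    simp only [Function.comp_apply, recenter, su2Chart_ilog, su2Quat_mul, su2Quat_iexp]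
  rw [heq]
  have hf : DifferentiableAt ℝ (fun A : VecField P k E3 => A b) (0 : VecField P k E3) := differentiableAt_apply b _
  have hg : DifferentiableAt ℝ (fun a : E3 => logVec (exp (imQuat a) * exp (imQuat (X b))))
      ((fun A : VecField P k E3 => A b) 0) := differentiableAt_log_exp_mul (hX b)
  exact hg.comp (0 : VecField P k E3) hf

/-- **DIFFERENTIABILITY AT A CHART POINT ⇒ DIFFERENTIABILITY OF THE RE-CENTRED CHART**: if print's function `B′ ↦ f(exp(iB′)·U)` is
differentiable at `X` (`|X(b)| < π`), then `A ↦ f(exp(iA)·(exp(iX)·U))` has a Fréchet derivative at `0` — the letter `hF` of the g4 endpoint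
from a letter about print's own function. [cite: Balaban1989LargeFieldII, p.359 («We expand the function with respect to B′»)] -/
theorem exists_hasFDerivAt_of_differentiableAt (f : GaugeField P k SU2 → ℝ) (U : GaugeField P k SU2) {X : VecField P k E3}
    (hX : ∀ b, ‖X b‖ < π) (hg : DifferentiableAt ℝ (fun B' : VecField P k E3 => f (expMul su2Chart B' U)) X) :
    ∃ D : VecField P k E3 →L[ℝ] ℝ, HasFDerivAt (fun A => f (expMul su2Chart A (expMul su2Chart X U))) D 0 := by
  have heq : (fun A => f (expMul su2Chart A (expMul su2Chart X U))) =
      (fun B' : VecField P k E3 => f (expMul su2Chart B' U)) ∘ recenter X := by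
    funext A; rw [Function.comp_apply, expMul_recenter]
  have hd : DifferentiableAt ℝ ((fun B' : VecField P k E3 => f (expMul su2Chart B' U)) ∘ recenter X) 0 := by
    refine DifferentiableAt.comp 0 ?_ (differentiableAt_recenter hX)
    rw [recenter_zero hX]; exact hg
  rw [heq]
  exact ⟨_, hd.hasFDerivAt⟩

end Lattice

/-! ## §3 The N12∕s1 endpoint with the letters (c3) and `hF` both derived -/

section Knit

/-- **PROPOSITION 1 [IV] FOR PRINT'S FUNCTION (1.77) AT `SU(2)` ON PARALLELEPIPEDS — (c3) DERIVED, THE DIFFERENTIABILITY LETTER IN PRINT'S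
COORDINATES.**  `B15Prop1CriticalAtBoxG0.exists_domain_prop1Printed_lfVarOn_std_su2_box_of_fderiv` with `hF` REPLACED by
`hG : DifferentiableAt ℝ (B′ ↦ A(U_{k,Z}(exp(iB′)·Ṽ_k))) (ιA B)` for `‖B‖ ≤ r` (`exists_hasFDerivAt_of_differentiableAt`, `‖ιA B (b)‖ ≤ ‖B‖ ≤
1/2 < π`). [cite: Balaban1989LargeFieldI, Prop. 1 (1.77)–(1.78) p.194, p.193; Balaban1989LargeFieldII, pp.357–359, (1.12); Balaban1985Variational,
Prop. 4 pp.292–293, (181) p.307, (190) p.308] -/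
theorem exists_domain_prop1Printed_lfVarOn_std_su2_box_of_differentiableAt (hd3 : 3 ≤ P.d) (h0 : 0 < P.d) {ι : Type}
    {av : ∀ j, Averaging P j SU2}
    (bg : DetBackground P SU2 av) (M₁ : ℕ) (Z Λ : ι → Set (Site P 0)) (k : ι → ℕ) (M : ι → ℝ)
    (An : ∀ i, ℝ → GaugeField P (k i) SU2 → Prop) (hk : ∀ i, k i ≤ P.m + P.K)
    (h181 : ∀ i (u : GaugeTransf P (k i) SU2), Cov181 bg (Bj M₁ (Z i) (k i)) (blockLift (k i) u))
    (T : ∀ i, Finset (PBond P (k i)))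
    {F : ι → Type*} [∀ i, NormedAddCommGroup (F i)] [∀ i, InnerProductSpace ℝ (F i)] [∀ i, FiniteDimensional ℝ (F i)]
    (H : ∀ i, GaugeField P (k i) SU2 →
      (GaugeSlice (pts (k i) (Λ i)) (T i) (EuclideanSpace ℝ (Fin 3)) →ₗ[ℝ] F i))
    (Δ₁ : ∀ i, GaugeField P (k i) SU2 → (F i →ₗ[ℝ] F i)) (dV : ∀ i, GaugeField P (k i) SU2 → F i → F i)
    {Fc : ι → Type*} [∀ i, NormedAddCommGroup (Fc i)] [∀ i, NormedSpace ℂ (Fc i)] (emb : ∀ i, F i → Fc i)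
    (hemb : ∀ i (u v : F i), ‖emb i u - emb i v‖ = ‖u - v‖) (hemb0 : ∀ i, emb i 0 = 0)
    (W : ∀ i, GaugeField P (k i) SU2 → Fc i → Fc i) {C₄ a₃ a : ι → ℝ} (hC₄ : ∀ i, 0 ≤ C₄ i) (ha : ∀ i, 0 < a i)
    (hW : ∀ i Vk, Prop4Hyp (W i Vk) (C₄ i) (a₃ i)) (hWdV : ∀ i Vk (u : F i), W i Vk (emb i u) = emb i (dV i Vk u))
    (J : ∀ i, GaugeField P (k i) SU2 → F i)
    (lo hi : ι → Fin P.d → ℤ) (n : ι → ℕ) (hn : ∀ i κ, hi i κ ≤ lo i κ + n i) (hN : ∀ i, n i + 2 < P.sitesPerDir (k i))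
    (hbox : ∀ i, pts (k i) (Λ i) = (castSite '' Set.Icc (lo i) (hi i) : Set (Site P (k i))))
    (hZ : ∀ i, (boxPlaqs (lo i - 1) (hi i + 1) : Set (Plaq P (k i))) ⊆ plaqsInside (pts (k i) (Z i)))
    (hTG0 : ∀ i, T i = (box (fun κ => (hi i κ - lo i κ + 1).toNat) (lo i)).image fun x =>
      (⟨castSite (x - unitVec ⟨0, h0⟩), ⟨0, h0⟩⟩ : PBond P (k i)))
    (hN5 : ∀ i κ, ((hi i κ - lo i κ + 1).toNat : ℤ) + 5 < P.sitesPerDir (k i))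
    (K : ι → ℕ) (hK1 : ∀ i, 1 ≤ K i) (hKn : ∀ i κ, (hi i κ - lo i κ + 1).toNat ≤ K i)
    (ext : ∀ i, GaugeField P (k i) SU2 → GaugeField P (k i) SU2)
    (hext : ∀ i Vk, ext i Vk = extend (pts (k i) (Λ i)) (shellGauge Vk (lo i) (hi i)) Vk)
    (hlohi : ∀ i, lo i ≤ hi i)
    {γ h₁ cJ bx : ℝ} (hγ : 0 < γ) (hh₁ : 0 ≤ h₁) (hcJ : 0 ≤ cJ) (hbx : 0 ≤ bx)
    (hbxM : ∀ i, 12 * (P.d : ℝ) * ((n i : ℝ) + 2) ^ 2 ≤ bx * (M i) ^ 2)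
    {ρ r eA Cerr : ι → ℝ} (hr : ∀ i, 0 < r i) (heA : ∀ i, 0 < eA i) (hM : ∀ i, 1 ≤ (M i))
    (n' : ι → ℕ) (hn' : ∀ i, 1 ≤ n' i)
    (hlead : ∀ i Vk (X : GaugeSlice (pts (k i) (Λ i)) (T i) (EuclideanSpace ℝ (Fin 3))),
      |⟪H i Vk X, Δ₁ i Vk (H i Vk X)⟫ -
          ∑ a : Fin 3, formDk (n' i) (fun _ : Fin P.d => P.sitesPerDir (k i))
            (ofRealCfg (fun _ : Fin P.d => P.sitesPerDir (k i)) fun j =>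
              ιA (pts (k i) (Λ i)) (T i) X ⟨j.1, j.2⟩ a)| ≤ Cerr i * ‖X‖ ^ 2)
    (hsm : ∀ i, Cerr i ≤ (4 / Real.pi ^ 2) ^ (P.d + 2) / (2 * (3 * (K i : ℝ) ^ 2 + 2 * (K i : ℝ) ^ 4)))
    (hγle : ∀ i, γ / (M i) ^ 5 ≤ (4 / Real.pi ^ 2) ^ (P.d + 2) / (2 * (3 * (K i : ℝ) ^ 2 + 2 * (K i : ℝ) ^ 4)))
    (hH : ∀ i Vk x, ‖H i Vk x‖ ≤ h₁ * ‖x‖)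
    (hρ : ∀ i, h₁ * r i ≤ ρ i) (ha₃ : ∀ i, 2 * (ρ i + a i) ≤ a₃ i)
    (hsmall : ∀ i, (M i) ^ 5 / γ * h₁ * (4 * C₄ i * (ρ i + a i)) * h₁ ≤ 1 / 2)
    (hA : ∀ i Vk (X δ : GaugeSlice (pts (k i) (Λ i)) (T i) (EuclideanSpace ℝ (Fin 3))),
      HasDerivAt (fun s : ℝ => (fun177std bg M₁ (Z i) (k i)) (expMul su2Chart (ιA (pts (k i) (Λ i)) (T i) (X + s • δ)) (ext i Vk)))
      (⟪H i Vk δ, J i Vk⟫ + ⟪H i Vk δ, Δ₁ i Vk (H i Vk X)⟫ + ⟪H i Vk δ, dV i Vk (H i Vk X)⟫) 0)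
    (hJ : ∀ i ε Vk, 0 < ε → PlaqSmallOn (plaqsInside (pts (k i) (Z i ∩ (Λ i)ᶜ))) ε Vk → ‖J i Vk‖ ≤ cJ * ε)
    -- (c3) and `hF` DERIVED; the differentiability letter is about print's function of `B′`, at the chart points of the ball
    (hG : ∀ i Vk (B : GaugeSlice (pts (k i) (Λ i)) (T i) (EuclideanSpace ℝ (Fin 3))), ‖B‖ ≤ r i →
      DifferentiableAt ℝ (fun B' : VecField P (k i) (EuclideanSpace ℝ (Fin 3)) =>
        (fun177std bg M₁ (Z i) (k i)) (expMul su2Chart B' (ext i Vk))) (ιA (pts (k i) (Λ i)) (T i) B))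
    (hr2 : ∀ i, r i ≤ 1 / 2)
    (hAn : ∀ i ε Vk, 0 < ε → ε ≤ eA i → PlaqSmallOn (plaqsInside (pts (k i) (Z i ∩ (Λ i)ᶜ))) ε Vk → An i ε Vk)
    : ∃ a₁ : ι → ℝ, (∀ i, 0 < a₁ i) ∧
      B15.Prop1Printed (lfVarOn su2Chart fun i => InstOn.std bg M₁ (Z i) (Λ i) (k i) (M i) (a₁ i) (An i)) := by
  refine exists_domain_prop1Printed_lfVarOn_std_su2_box_of_fderiv hd3 h0 bg M₁ Z Λ k M An hk h181 T H Δ₁ dV emb hemb hemb0 W hC₄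
    ha hW hWdV J lo hi n hn hN hbox hZ hTG0 hN5 K hK1 hKn ext hext hlohi hγ hh₁ hcJ hbx hbxM hr heA hM n' hn' hlead hsm hγle hH hρ
    ha₃ hsmall hA hJ (fun i Vk B hB => ?_) hr2 hAn
  have hX : ∀ b, ‖ιA (pts (k i) (Λ i)) (T i) B b‖ < π := fun b =>
    (norm_ιA_apply_le B b).trans_lt (hB.trans_lt ((hr2 i).trans_lt (by linarith [Real.pi_gt_three])))
  exact exists_hasFDerivAt_of_differentiableAt _ (ext i Vk) hX (hG i Vk B hB)

end Knit

end Literature.MathematicalPhysics.QuantumFieldTheory.Balaban1983to89.B15Prop1ChartRecentering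

end
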